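import Mathlib
import HarnessLib
import Summits.AtomisticToContinuum.FouriersLaw.Theses.JunctionLocality
import Literature.MathematicalPhysics.KineticTheory.LangevinChainGibbs
import Summits.AtomisticToContinuum.FouriersLaw.Theorems.JunctionLocalitySuperadditiveResistanceDeviceLineCalculus

/-!
# The γ-probed device at equilibrium, III: the cutoff profile and the bounds for the pinned chain

Part III of the helper development for stub `stub_linearResponse` (line
`thermalise-then-cut-probe-insertion`, crux stmt-AtomisticToContinuum-11748); see `…DeviceLiouville`
for the overview. Content: a smooth profile `φ = b² : ℝ → [0,1]` (`b` a bump), `φ = 1` on `[-1,1]`,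
`φ = 0` off `(-2,2)`, with the sub-quadratic bound `(φ′)² ≤ Kφ` (`exists_profile`); for the pinned
chain (`H ≥ 0`, `p² ≤ 2H`) the uniform bound `|S_B φ(H/r)| ≤ (ΣB)K(5T+4)` (`r ≥ 1`), the
vanishing of `S_B φ(H/r)` on `{H < r}`, the transported bound `(∂_{p_i}φ(H/r))² ≤ (4K/r) φ(H/r)`,
and the weak `μ_T`-conservativity `∫ (σ X_H F + c S_B F) e^{-H/T} = 0` for `F ∈ C²_c`
(`integral_genOp_mul_gibbsDensity`, from the tree's Gaussian integrations by parts).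
-/

noncomputable section

open MeasureTheory Filter Topology ProbabilityTheory
open scoped ContDiff NNReal
open Literature.MathematicalPhysics.KineticTheory.HeatConduction

namespace Summit.AtomisticToContinuum.FouriersLaw.Theorems.SuperadditiveResistance.DeviceLiouville

/-! ## A smooth cutoff profile with `(φ')² ≤ K φ` -/

section Profile

/-- Derivatives of a function vanish on an open set where it is constant. [folklore] -/
theorem deriv_eq_zero_of_eventuallyEq_const {φ : ℝ → ℝ} {s : ℝ} {a : ℝ}
    (h : φ =ᶠ[𝓝 s] fun _ => a) : deriv φ s = 0 := by
  rw [h.deriv_eq]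
  exact deriv_const s a

/-- A smooth profile `φ : ℝ → [0,1]`, `φ = 1` on `[-1,1]`, `φ = 0` off `(-2,2)`, with bounded first
and second derivatives, derivatives vanishing where `φ` is locally constant, and the key
sub-quadratic bound `(φ')² ≤ K φ` (take `φ = b²` for a smooth bump `b`). [folklore] -/
theorem exists_profile : ∃ (φ : ℝ → ℝ) (K : ℝ), ContDiff ℝ ∞ φ ∧ (∀ s, |s| ≤ 1 → φ s = 1) ∧
    (∀ s, 2 ≤ |s| → φ s = 0) ∧ (∀ s, 0 ≤ φ s) ∧ (∀ s, φ s ≤ 1) ∧ 0 ≤ K ∧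
    (∀ s, deriv φ s ^ 2 ≤ K * φ s) ∧ (∀ s, |deriv φ s| ≤ K) ∧
    (∀ s, |deriv (deriv φ) s| ≤ K) ∧
    (∀ s, |s| < 1 → deriv φ s = 0 ∧ deriv (deriv φ) s = 0) ∧
    (∀ s, 2 < |s| → deriv φ s = 0 ∧ deriv (deriv φ) s = 0) := by
  let b : ContDiffBump (0 : ℝ) := ⟨1, 2, one_pos, one_lt_two⟩
  have hb : ContDiff ℝ ∞ (b : ℝ → ℝ) := b.contDiff
  have hb1 : Differentiable ℝ (b : ℝ → ℝ) := hb.differentiable (by simp)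
  have hb' : ContDiff ℝ ∞ (deriv (b : ℝ → ℝ)) := hb.deriv'
  have hb2 : Differentiable ℝ (deriv (b : ℝ → ℝ)) := hb'.differentiable (by simp)
  obtain ⟨K₁, hK₁⟩ := (hb'.continuous).bounded_above_of_compact_support b.hasCompactSupport.deriv
  have hb'' : ContDiff ℝ ∞ (deriv (deriv (b : ℝ → ℝ))) := hb'.deriv'
  obtain ⟨K₂, hK₂⟩ := (hb''.continuous).bounded_above_of_compact_support
    b.hasCompactSupport.deriv.deriv
  have hK₁0 : 0 ≤ K₁ := (norm_nonneg _).trans (hK₁ 0)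
  have hK₂0 : 0 ≤ K₂ := (norm_nonneg _).trans (hK₂ 0)
  set φ : ℝ → ℝ := fun s => (b : ℝ → ℝ) s ^ 2 with hφ
  have hdφ : deriv φ = fun s => 2 * b s * deriv (b : ℝ → ℝ) s := by
    funext s
    rw [((hb1 s).hasDerivAt.fun_pow 2).deriv]
    simp
  have hddφ : deriv (deriv φ) = fun s =>
      2 * deriv (b : ℝ → ℝ) s * deriv (b : ℝ → ℝ) s + 2 * b s * deriv (deriv (b : ℝ → ℝ)) s := by
    rw [hdφ]
    funext s
    have := (((hb1 s).hasDerivAt.const_mul 2).fun_mul (hb2 s).hasDerivAt).deriv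
    rw [this]
  -- local constancy
  have hone : ∀ s : ℝ, |s| < 1 → φ =ᶠ[𝓝 s] fun _ => 1 := by
    intro s hs
    have ho : IsOpen {t : ℝ | |t| < 1} := isOpen_lt continuous_abs continuous_const
    filter_upwards [ho.mem_nhds hs] with t ht
    have : (b : ℝ → ℝ) t = 1 := b.one_of_mem_closedBall (by simpa [b] using ht.le)
    simp [hφ, this]
  have hzero : ∀ s : ℝ, 2 < |s| → φ =ᶠ[𝓝 s] fun _ => 0 := by
    intro s hs
    have ho : IsOpen {t : ℝ | 2 < |t|} := isOpen_lt continuous_const continuous_abs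
    filter_upwards [ho.mem_nhds hs] with t ht
    have : (b : ℝ → ℝ) t = 0 := b.zero_of_le_dist (by simpa [b] using ht.le)
    simp [hφ, this]
  have hd1 : ∀ s : ℝ, |s| < 1 → deriv φ s = 0 := fun s hs =>
    deriv_eq_zero_of_eventuallyEq_const (hone s hs)
  have hd2 : ∀ s : ℝ, 2 < |s| → deriv φ s = 0 := fun s hs =>
    deriv_eq_zero_of_eventuallyEq_const (hzero s hs)
  have hdd1 : ∀ s : ℝ, |s| < 1 → deriv (deriv φ) s = 0 := by
    intro s hs
    apply deriv_eq_zero_of_eventuallyEq_const (a := 0)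
    have ho : IsOpen {t : ℝ | |t| < 1} := isOpen_lt continuous_abs continuous_const
    filter_upwards [ho.mem_nhds hs] with t ht
    exact hd1 t ht
  have hdd2 : ∀ s : ℝ, 2 < |s| → deriv (deriv φ) s = 0 := by
    intro s hs
    apply deriv_eq_zero_of_eventuallyEq_const (a := 0)
    have ho : IsOpen {t : ℝ | 2 < |t|} := isOpen_lt continuous_const continuous_abs
    filter_upwards [ho.mem_nhds hs] with t ht
    exact hd2 t ht
  have hbabs : ∀ s, |(b : ℝ → ℝ) s| ≤ 1 := fun s => by
    rw [abs_of_nonneg b.nonneg]; exact b.le_one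
  have hb'abs : ∀ s, |deriv (b : ℝ → ℝ) s| ≤ K₁ := fun s => by
    have := hK₁ s; rwa [Real.norm_eq_abs] at this
  have hb''abs : ∀ s, |deriv (deriv (b : ℝ → ℝ)) s| ≤ K₂ := fun s => by
    have := hK₂ s; rwa [Real.norm_eq_abs] at this
  refine ⟨φ, 4 * K₁ ^ 2 + 2 * K₁ + 2 * K₂, hb.pow 2, ?_, ?_, ?_, ?_, by positivity, ?_, ?_, ?_,
    fun s hs => ⟨hd1 s hs, hdd1 s hs⟩, fun s hs => ⟨hd2 s hs, hdd2 s hs⟩⟩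
  · intro s hs
    have : (b : ℝ → ℝ) s = 1 := b.one_of_mem_closedBall (by simpa [b] using hs)
    simp [hφ, this]
  · intro s hs
    have : (b : ℝ → ℝ) s = 0 := b.zero_of_le_dist (by simpa [b] using hs)
    simp [hφ, this]
  · intro s; positivity
  · intro s
    have h0 := b.nonneg (x := s)
    have h1 := b.le_one (x := s)
    show (b : ℝ → ℝ) s ^ 2 ≤ 1
    nlinarith
  · intro s
    rw [hdφ]
    show (2 * b s * deriv (b : ℝ → ℝ) s) ^ 2 ≤ (4 * K₁ ^ 2 + 2 * K₁ + 2 * K₂) * ((b : ℝ → ℝ) s ^ 2)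
    have h0 := b.nonneg (x := s)
    have hsq : deriv (b : ℝ → ℝ) s ^ 2 ≤ K₁ ^ 2 := by
      have := hb'abs s
      rw [← sq_abs]
      exact pow_le_pow_left₀ (abs_nonneg _) this 2
    have hb2s : 0 ≤ (b : ℝ → ℝ) s ^ 2 := sq_nonneg _
    nlinarith [mul_le_mul_of_nonneg_left hsq hb2s]
  · intro s
    rw [hdφ]
    show |2 * b s * deriv (b : ℝ → ℝ) s| ≤ 4 * K₁ ^ 2 + 2 * K₁ + 2 * K₂
    rw [abs_mul, abs_mul, abs_two]
    have := mul_le_mul (hbabs s) (hb'abs s) (abs_nonneg _) zero_le_one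
    nlinarith [abs_nonneg (deriv (b : ℝ → ℝ) s), abs_nonneg ((b : ℝ → ℝ) s)]
  · intro s
    rw [hddφ]
    show |2 * deriv (b : ℝ → ℝ) s * deriv (b : ℝ → ℝ) s + 2 * b s * deriv (deriv (b : ℝ → ℝ)) s| ≤
      4 * K₁ ^ 2 + 2 * K₁ + 2 * K₂
    have h1 : |2 * deriv (b : ℝ → ℝ) s * deriv (b : ℝ → ℝ) s| ≤ 2 * K₁ ^ 2 := by
      rw [abs_mul, abs_mul, abs_two]
      have := mul_le_mul (hb'abs s) (hb'abs s) (abs_nonneg _) hK₁0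
      nlinarith
    have h2 : |2 * b s * deriv (deriv (b : ℝ → ℝ)) s| ≤ 2 * K₂ := by
      rw [abs_mul, abs_mul, abs_two]
      have := mul_le_mul (hbabs s) (hb''abs s) (abs_nonneg _) zero_le_one
      nlinarith [abs_nonneg (deriv (deriv (b : ℝ → ℝ)) s), abs_nonneg ((b : ℝ → ℝ) s)]
    have := abs_add_le (2 * deriv (b : ℝ → ℝ) s * deriv (b : ℝ → ℝ) s)
      (2 * b s * deriv (deriv (b : ℝ → ℝ)) s)
    nlinarith

end Profile

/-! ## Bounds for the pinned chain and the weak conservativity of `σ X_H + c S_B` -/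

section Bounds

variable {ω₂ lam β : ℝ} {L : ℕ}

/-- `p_i² ≤ 2H` for the pinned chain (`lam, β, ω₂ ≥ 0`). [folklore] -/
theorem pinnedChain_sq_le_two_mul_hamiltonian (hω : 0 ≤ ω₂) (hl : 0 ≤ lam) (hβ : 0 ≤ β) (γ : ℝ)
    (L : ℕ) (x : PhaseSpace L) (i : Fin L) :
    x.2 i ^ 2 ≤ 2 * (pinnedChain ω₂ lam β γ).hamiltonian L x := by
  have h := pinnedChain_harmonic_le_hamiltonian (ω₂ := ω₂) hl hβ γ L x
  have h1 : x.2 i ^ 2 / 2 ≤ ∑ j, x.2 j ^ 2 / 2 :=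
    Finset.single_le_sum (f := fun j => x.2 j ^ 2 / 2) (fun j _ => by positivity)
      (Finset.mem_univ i)
  have h2 : 0 ≤ ∑ j, ω₂ * x.1 j ^ 2 / 2 := Finset.sum_nonneg fun j _ => by positivity
  linarith

variable (P : OscillatorChain)

/-- The cutoff equals `1` on `{H ≤ r}` (`H ≥ 0`, `r > 0`). [folklore] -/
theorem cutoff_eq_one {φ : ℝ → ℝ} (hφ1 : ∀ s, |s| ≤ 1 → φ s = 1) {r : ℝ} (hr : 0 < r)
    {x : PhaseSpace L} (hH0 : 0 ≤ P.hamiltonian L x) (hx : P.hamiltonian L x ≤ r) :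
    cutoff P φ L r x = 1 := by
  unfold cutoff
  apply hφ1
  rw [abs_of_nonneg (div_nonneg hH0 hr.le), div_le_one hr]
  exact hx

/-- The cutoff vanishes on `{2r ≤ H}`. [folklore] -/
theorem cutoff_eq_zero {φ : ℝ → ℝ} (hφ0 : ∀ s, 2 ≤ |s| → φ s = 0) {r : ℝ} (hr : 0 < r)
    {x : PhaseSpace L} (hH0 : 0 ≤ P.hamiltonian L x) (hx : 2 * r ≤ P.hamiltonian L x) :
    cutoff P φ L r x = 0 := by
  unfold cutoff
  apply hφ0
  rw [abs_of_nonneg (div_nonneg hH0 hr.le), le_div_iff₀ hr]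
  exact hx

/-- `0 ≤ cutoff ≤ 1`. [folklore] -/
theorem cutoff_nonneg {φ : ℝ → ℝ} (hφ : ∀ s, 0 ≤ φ s) (r : ℝ) (x : PhaseSpace L) :
    0 ≤ cutoff P φ L r x := hφ _

/-- `cutoff ≤ 1`. [folklore] -/
theorem cutoff_le_one {φ : ℝ → ℝ} (hφ : ∀ s, φ s ≤ 1) (r : ℝ) (x : PhaseSpace L) :
    cutoff P φ L r x ≤ 1 := hφ _

/-- Nestedness substitute: `cutoff r ≤ cutoff r'` as soon as `2r ≤ r'`. [folklore] -/
theorem cutoff_le_cutoff {φ : ℝ → ℝ} (hφ1 : ∀ s, |s| ≤ 1 → φ s = 1)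
    (hφ0 : ∀ s, 2 ≤ |s| → φ s = 0) (hφnn : ∀ s, 0 ≤ φ s) (hφle : ∀ s, φ s ≤ 1) {r r' : ℝ}
    (hr : 0 < r) (hrr' : 2 * r ≤ r') {x : PhaseSpace L} (hH0 : 0 ≤ P.hamiltonian L x) :
    cutoff P φ L r x ≤ cutoff P φ L r' x := by
  by_cases hx : P.hamiltonian L x ≤ 2 * r
  · rw [cutoff_eq_one P hφ1 (by linarith) hH0 (hx.trans hrr')]
    exact cutoff_le_one P hφle r x
  · rw [cutoff_eq_zero P hφ0 hr hH0 (le_of_not_ge hx)]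
    exact cutoff_nonneg P hφnn r' x

/-- Below level `r` the thermostats do not see the cutoff: `S_B φ(H/r) = 0` on `{H < r}`. [folklore] -/
theorem bathOp_cutoff_eq_zero {φ : ℝ → ℝ} (hφ : ContDiff ℝ 2 φ)
    (hd1 : ∀ s, |s| < 1 → deriv φ s = 0 ∧ deriv (deriv φ) s = 0)
    (hH : Differentiable ℝ (P.hamiltonian L)) (B : Fin L → ℝ) (T : ℝ) {r : ℝ} (hr : 0 < r)
    {x : PhaseSpace L} (hH0 : 0 ≤ P.hamiltonian L x) (hx : P.hamiltonian L x < r) :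
    bathOp L B T (cutoff P φ L r) x = 0 := by
  rw [bathOp_cutoff hφ hH]
  have : |P.hamiltonian L x / r| < 1 := by
    rw [abs_of_nonneg (div_nonneg hH0 hr.le), div_lt_one hr]
    exact hx
  obtain ⟨h1, h2⟩ := hd1 _ this
  simp [h1, h2]

variable {P}

/-- Uniform bound on the thermostats of the cutoff for the pinned chain:
`|S_B φ(H/r)| ≤ (Σ B) K (5T + 4)` for `r ≥ 1` (on the transition layer `p² ≤ 2H ≤ 4r`). [folklore] -/
theorem abs_bathOp_cutoff_le (hω : 0 ≤ ω₂) (hl : 0 ≤ lam) (hβ : 0 ≤ β) (γ : ℝ) (L : ℕ)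
    {φ : ℝ → ℝ} {K : ℝ} (hφ : ContDiff ℝ 2 φ) (hK : 0 ≤ K) (hd : ∀ s, |deriv φ s| ≤ K)
    (hdd : ∀ s, |deriv (deriv φ) s| ≤ K)
    (hd2 : ∀ s, 2 < |s| → deriv φ s = 0 ∧ deriv (deriv φ) s = 0)
    (B : Fin L → ℝ) (hB : ∀ i, 0 ≤ B i) {T : ℝ} (hT : 0 ≤ T) {r : ℝ} (hr : 1 ≤ r)
    (x : PhaseSpace L) :
    |bathOp L B T (cutoff (pinnedChain ω₂ lam β γ) φ L r) x| ≤ (∑ i, B i) * (K * (5 * T + 4)) := by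
  have hHd : Differentiable ℝ ((pinnedChain ω₂ lam β γ).hamiltonian L) :=
    ((pinnedChain ω₂ lam β γ).contDiff_hamiltonian (pinnedChain_contDiff_U ω₂ lam β γ (n := 1))
      (pinnedChain_contDiff_V ω₂ lam β γ (n := 1)) L).differentiable one_ne_zero
  have hH0 : 0 ≤ (pinnedChain ω₂ lam β γ).hamiltonian L x :=
    pinnedChain_hamiltonian_nonneg hω hl hβ γ L x
  have hr0 : 0 < r := by linarith
  rw [bathOp_cutoff hφ hHd]
  generalize hE : (pinnedChain ω₂ lam β γ).hamiltonian L x = E at hH0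
  by_cases hcase : 2 < |E / r|
  · obtain ⟨h1, h2⟩ := hd2 _ hcase
    simp only [h1, h2, zero_mul, mul_zero, zero_div, add_zero, sub_zero, Finset.sum_const_zero,
      abs_zero]
    exact mul_nonneg (Finset.sum_nonneg fun i _ => hB i) (by positivity)
  · have hHle : E ≤ 2 * r := by
      rw [not_lt, abs_of_nonneg (div_nonneg hH0 hr0.le), div_le_iff₀ hr0] at hcase
      exact hcase
    have hp : ∀ i : Fin L, x.2 i ^ 2 ≤ 4 * r := fun i =>
      (hE ▸ pinnedChain_sq_le_two_mul_hamiltonian hω hl hβ γ L x i).trans (by linarith)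
    generalize ha : deriv (deriv φ) (E / r) = a
    generalize hd' : deriv φ (E / r) = d
    have haK : |a| ≤ K := ha ▸ hdd _
    have hdK : |d| ≤ K := hd' ▸ hd _
    rw [Finset.sum_mul]
    refine (Finset.abs_sum_le_sum_abs _ _).trans (Finset.sum_le_sum fun i _ => ?_)
    rw [abs_mul, abs_of_nonneg (hB i)]
    refine mul_le_mul_of_nonneg_left ?_ (hB i)
    have e : T * (a * (x.2 i / r) ^ 2 + d / r) - x.2 i * (d * (x.2 i / r)) =
        T * a * (x.2 i ^ 2 / r ^ 2) + T * d * (1 / r) - d * (x.2 i ^ 2 / r) := by ring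
    rw [e]
    have h1 : |T * a * (x.2 i ^ 2 / r ^ 2)| ≤ 4 * T * K := by
      rw [abs_mul, abs_mul, abs_of_nonneg hT, abs_of_nonneg (by positivity : 0 ≤ x.2 i ^ 2 / r ^ 2)]
      calc T * |a| * (x.2 i ^ 2 / r ^ 2) ≤ T * K * (4 * r / r ^ 2) := by
            gcongr
            exact hp i
        _ = 4 * T * K / r := by field_simp
        _ ≤ 4 * T * K := div_le_self (by positivity) hr
    have h2 : |T * d * (1 / r)| ≤ T * K := by
      rw [abs_mul, abs_mul, abs_of_nonneg hT, abs_of_nonneg (by positivity : 0 ≤ 1 / r)]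
      calc T * |d| * (1 / r) ≤ T * K * (1 / r) := by gcongr
        _ = T * K / r := by ring
        _ ≤ T * K := div_le_self (by positivity) hr
    have h3 : |d * (x.2 i ^ 2 / r)| ≤ 4 * K := by
      rw [abs_mul, abs_of_nonneg (by positivity : 0 ≤ x.2 i ^ 2 / r)]
      calc |d| * (x.2 i ^ 2 / r) ≤ K * (4 * r / r) := by
            gcongr
            exact hp i
        _ = 4 * K := by field_simp
    calc |T * a * (x.2 i ^ 2 / r ^ 2) + T * d * (1 / r) - d * (x.2 i ^ 2 / r)|
        ≤ |T * a * (x.2 i ^ 2 / r ^ 2) + T * d * (1 / r)| + |d * (x.2 i ^ 2 / r)| := abs_sub _ _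
      _ ≤ |T * a * (x.2 i ^ 2 / r ^ 2)| + |T * d * (1 / r)| + |d * (x.2 i ^ 2 / r)| := by
          gcongr
          exact abs_add_le _ _
      _ ≤ 4 * T * K + T * K + 4 * K := by linarith
      _ = K * (5 * T + 4) := by ring

/-- The sub-quadratic bound transported to phase space:
`(∂_{p_i} φ(H/r))² ≤ (4K/r) φ(H/r)` for `r ≥ 1`. [folklore] -/
theorem partialP_cutoff_sq_le (hω : 0 ≤ ω₂) (hl : 0 ≤ lam) (hβ : 0 ≤ β) (γ : ℝ) (L : ℕ)
    {φ : ℝ → ℝ} {K : ℝ} (hφ : Differentiable ℝ φ) (hK : 0 ≤ K) (hφnn : ∀ s, 0 ≤ φ s)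
    (hdsq : ∀ s, deriv φ s ^ 2 ≤ K * φ s)
    (hd2 : ∀ s, 2 < |s| → deriv φ s = 0 ∧ deriv (deriv φ) s = 0) {r : ℝ} (hr : 1 ≤ r)
    (i : Fin L) (x : PhaseSpace L) :
    partialP i (cutoff (pinnedChain ω₂ lam β γ) φ L r) x ^ 2 ≤
      4 * K / r * cutoff (pinnedChain ω₂ lam β γ) φ L r x := by
  have hHd : Differentiable ℝ ((pinnedChain ω₂ lam β γ).hamiltonian L) :=
    ((pinnedChain ω₂ lam β γ).contDiff_hamiltonian (pinnedChain_contDiff_U ω₂ lam β γ (n := 1))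
      (pinnedChain_contDiff_V ω₂ lam β γ (n := 1)) L).differentiable one_ne_zero
  have hH0 : 0 ≤ (pinnedChain ω₂ lam β γ).hamiltonian L x :=
    pinnedChain_hamiltonian_nonneg hω hl hβ γ L x
  have hr0 : 0 < r := by linarith
  have hp2 := pinnedChain_sq_le_two_mul_hamiltonian hω hl hβ γ L x i
  rw [partialP_cutoff hφ hHd]
  unfold cutoff
  generalize hE : (pinnedChain ω₂ lam β γ).hamiltonian L x = E at hH0 hp2
  by_cases hcase : 2 < |E / r|
  · rw [(hd2 _ hcase).1]
    simp only [zero_mul, ne_eq, OfNat.ofNat_ne_zero, not_false_eq_true, zero_pow]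
    exact mul_nonneg (by positivity) (hφnn _)
  · have hHle : E ≤ 2 * r := by
      rw [not_lt, abs_of_nonneg (div_nonneg hH0 hr0.le), div_le_iff₀ hr0] at hcase
      exact hcase
    have hp : x.2 i ^ 2 ≤ 4 * r := hp2.trans (by linarith)
    calc (deriv φ (E / r) * (x.2 i / r)) ^ 2
        = deriv φ (E / r) ^ 2 * (x.2 i ^ 2 / r ^ 2) := by ring
      _ ≤ (K * φ (E / r)) * (4 * r / r ^ 2) := by
          refine mul_le_mul (hdsq _) ?_ (by positivity) (mul_nonneg hK (hφnn _))
          gcongr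
      _ = 4 * K / r * φ (E / r) := by field_simp

variable (P)

/-- **Weak conservativity of `σ X_H + c S_B` for the Gibbs density.** For an `OscillatorChain`
with `C¹` potentials, any sign/strength `σ` of the Hamiltonian part, any site weights `B` and
all thermostats at the Gibbs temperature `T ≠ 0`:
`∫ (σ X_H F + c S_B F) e^{-H/T} dq dp = 0` for `F ∈ C²_c`
(`integral_liouville_mul_gibbsDensity` + `integral_bath_mul_gibbsDensity` with `T_b = T`). [folklore] -/
theorem integral_genOp_mul_gibbsDensity (hU : ContDiff ℝ 1 P.U) (hV : ContDiff ℝ 1 P.V) (L : ℕ)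
    (B : Fin L → ℝ) {T : ℝ} (hT : T ≠ 0) (σ c : ℝ) {F : PhaseSpace L → ℝ} (hF : ContDiff ℝ 2 F)
    (hFc : HasCompactSupport F) :
    ∫ x, (σ * liouvilleOp P L F x + c * bathOp L B T F x) * P.gibbsDensity L T x = 0 := by
  have hF1 : ContDiff ℝ 1 F := hF.of_le (by norm_num)
  have hFd : Differentiable ℝ F := hF.differentiable two_ne_zero
  have hH1 : ContDiff ℝ 1 (P.hamiltonian L) := P.contDiff_hamiltonian hU hV L
  have hρc : Continuous (P.gibbsDensity L T) :=
    P.continuous_gibbsDensity hU.continuous hV.continuous L T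
  have hQc : ∀ i, Continuous (partialQ i F) := fun i => continuous_partialQ hF1 one_ne_zero i
  have hPc : ∀ i, Continuous (partialP i F) := fun i => continuous_partialP hF1 one_ne_zero i
  have hP1 : ∀ i, ContDiff ℝ 1 (partialP i F) := fun i => contDiff_partialP hF (by norm_num) i
  have hPPc : ∀ i, Continuous (partialP i (partialP i F)) := fun i =>
    continuous_partialP (hP1 i) one_ne_zero i
  have hQs : ∀ i, HasCompactSupport (partialQ i F) := fun i => hasCompactSupport_partialQ hFd hFc i
  have hPs : ∀ i, HasCompactSupport (partialP i F) := fun i => hasCompactSupport_partialP hFd hFc i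
  have hPPs : ∀ i, HasCompactSupport (partialP i (partialP i F)) := fun i =>
    hasCompactSupport_partialP ((hP1 i).differentiable one_ne_zero) (hPs i) i
  have hWc : ∀ i, Continuous (partialQ i (P.hamiltonian L)) := fun i =>
    P.continuous_partialQ_hamiltonian hH1 i
  have intA : ∀ i, Integrable (fun x => (x.2 i * partialQ i F x -
      partialQ i (P.hamiltonian L) x * partialP i F x) * P.gibbsDensity L T x) := by
    intro i
    refine Continuous.integrable_of_hasCompactSupport (by fun_prop) ?_
    exact (((hQs i).mul_left (f := fun x : PhaseSpace L => x.2 i)).sub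
      ((hPs i).mul_left)).mul_right
  have intB : ∀ i, Integrable (fun x => B i * ((T * partialP i (partialP i F) x -
      x.2 i * partialP i F x) * P.gibbsDensity L T x)) := by
    intro i
    refine (Continuous.integrable_of_hasCompactSupport (by fun_prop) ?_).const_mul (B i)
    exact (((hPPs i).mul_left).sub ((hPs i).mul_left)).mul_right
  have hA : ∀ i, ∫ x, (x.2 i * partialQ i F x -
      partialQ i (P.hamiltonian L) x * partialP i F x) * P.gibbsDensity L T x = 0 := fun i =>
    P.integral_liouville_mul_gibbsDensity hU hV L T hF1 hFc i
  have hB : ∀ i, ∫ x, B i * ((T * partialP i (partialP i F) x -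
      x.2 i * partialP i F x) * P.gibbsDensity L T x) = 0 := by
    intro i
    rw [integral_const_mul, P.integral_bath_mul_gibbsDensity hU hV L T T hF hFc i, div_self hT,
      sub_self, zero_mul, mul_zero]
  have hsplit : (fun x => (σ * liouvilleOp P L F x + c * bathOp L B T F x) * P.gibbsDensity L T x) =
      fun x => σ * (∑ i : Fin L, (x.2 i * partialQ i F x -
        partialQ i (P.hamiltonian L) x * partialP i F x) * P.gibbsDensity L T x) +
        c * ∑ i : Fin L, B i * ((T * partialP i (partialP i F) x -
          x.2 i * partialP i F x) * P.gibbsDensity L T x) := by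
    funext x
    simp only [liouvilleOp, bathOp, Finset.sum_mul, add_mul, mul_assoc, Finset.mul_sum]
  rw [hsplit, integral_add, integral_const_mul, integral_const_mul,
    integral_finsetSum _ fun i _ => intA i, integral_finsetSum _ fun i _ => intB i]
  · simp [hA, hB]
  · exact (integrable_finsetSum _ fun i _ => intA i).const_mul σ
  · exact (integrable_finsetSum _ fun i _ => intB i).const_mul c

end Bounds

/-- Registered helper sub-goal `helper_deviceCutoff` (= `integral_genOp_mul_gibbsDensity` in stub
form): weak `μ_T`-conservativity of `σ X_H + c S_B`. [folklore] -/
theorem helper_deviceCutoff : ∀ (P : OscillatorChain), ContDiff ℝ 1 P.U → ContDiff ℝ 1 P.V → ∀ (L : ℕ) (B : Fin L → ℝ) {T : ℝ}, T ≠ 0 → ∀ (σ c : ℝ) {F : PhaseSpace L → ℝ}, ContDiff ℝ 2 F → HasCompactSupport F → ∫ x, (σ * liouvilleOp P L F x + c * bathOp L B T F x) * P.gibbsDensity L T x = 0 :=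
  fun P hU hV L B _ hT σ c _ hF hFc => integral_genOp_mul_gibbsDensity P hU hV L B hT σ c hF hFc

end Summit.AtomisticToContinuum.FouriersLaw.Theorems.SuperadditiveResistance.DeviceLiouville

end
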